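import Literature.NumberTheory.Sieve.PairShiu
import Literature.NumberTheory.LFunctions.MertensFormula
import HarnessLib

/-!
# The bivariate Shiu bound for rough numbers with divisor powers (Matomäki–Merikoski Lemma 3.1, sharp)

Topic `Literature/NumberTheory/Sieve`. Everything here is PROVED; no definition is introduced.
Corollaries of `PairShiu.pair_shiu` (the Brun–Titchmarsh theorem for the pair `(n, mn + h)`) for
the weights of Matomäki–Merikoski, *Siegel zeros, twin primes …* (arXiv:2112.11412), Lemma 3.1:
for `a, b ∈ ℕ` there are `C, X₀` with, for `X ≥ X₀`, `1 ≤ m ≤ X`, `1 ≤ h ≤ X`, `(m, h) = 1`,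
`2 ≤ z₁, z₂ ≤ X`,

`∑_{n ≤ X, n z₁-rough, (mn+h, P_h(z₂)) = 1} τ(n)^a τ(mn+h)^b`
`≤ C (h/φ(h))^{κ} ψ(m) (X/log² X) (log X/log z₁)^{2^a} (log X/log z₂)^{2^b}`,

`κ = 2 + 2^{a+b+2} + 2^b`, `ψ(m) = ∏_{p ∣ m, p ≠ 2}(p−1)/(p−2)` (`sum_rough_pair_divisors_pow_le`;
"`(k, P_h(z)) = 1`": every prime factor `p < z` of `k` divides `h`), with the SHARP exponents
`2^a, 2^b` of the source (which there come from Henriot's Nair–Tenenbaum bound) and polynomial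
dependence on `h/φ(h)`; and the same with plain `z₂`-roughness of `mn + h`
(`sum_rough_pair_divisors_pow_le'`). Inputs: `pair_shiu`, the divisor bound, and Mertens' second
theorem with rate (`Mertens.abs_primeRecipSum_sub_le`).

## References

* K. Matomäki, J. Merikoski, IMRN 2023 (arXiv:2112.11412), Lemma 3.1. [cite: MatomakiMerikoski2023, Lemma 3.1]
* P. Shiu, J. reine angew. Math. 313 (1980), 161–170, Theorem 1. [cite: Shiu1980, Theorem 1]
-/

noncomputable section

open Finset Real

namespace Literature.NumberTheory.Sieve

namespace PairShiu

/-! ### `h/φ(h)` and the local factors -/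

/-- `h/φ(h) = ∏_{p ∣ h} p/(p − 1)`. [folklore] -/
theorem self_div_totient_eq_prod {h : ℕ} (hh : h ≠ 0) :
    (h : ℝ) / Nat.totient h = ∏ p ∈ h.primeFactors, ((p : ℝ) / ((p : ℝ) - 1)) := by
  have key := Nat.totient_mul_prod_primeFactors h
  have hφ : (0 : ℝ) < Nat.totient h := by exact_mod_cast Nat.totient_pos.mpr (Nat.pos_of_ne_zero hh)
  have hP : (0 : ℝ) < ∏ p ∈ h.primeFactors, ((p : ℝ) - 1) :=
    Finset.prod_pos fun p hp => by
      have := (Nat.prime_of_mem_primeFactors hp).two_le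
      have : (2 : ℝ) ≤ p := by exact_mod_cast this
      linarith
  have keyR : (Nat.totient h : ℝ) * ∏ p ∈ h.primeFactors, (p : ℝ) = (h : ℝ) * ∏ p ∈ h.primeFactors, ((p : ℝ) - 1) := by
    have this : ∀ p ∈ h.primeFactors, ((p - 1 : ℕ) : ℝ) = (p : ℝ) - 1 := fun p hp => by
      have := (Nat.prime_of_mem_primeFactors hp).one_lt.le
      push_cast [Nat.cast_sub this]; ring
    rw [← Finset.prod_congr rfl this]
    have key' : ((Nat.totient h * ∏ p ∈ h.primeFactors, p : ℕ) : ℝ) =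
        ((h * ∏ p ∈ h.primeFactors, (p - 1) : ℕ) : ℝ) := by exact_mod_cast key
    push_cast at key'
    exact key'
  rw [Finset.prod_div_distrib, div_eq_div_iff hφ.ne' hP.ne']
  linarith

/-- `exp(∑_{p ∣ h} 1/p) ≤ h/φ(h)` (`e^{1/p} ≤ p/(p−1)`). [folklore] -/
theorem exp_sum_inv_primeFactors_le {h : ℕ} (hh : h ≠ 0) :
    Real.exp (∑ p ∈ h.primeFactors, 1 / (p : ℝ)) ≤ (h : ℝ) / Nat.totient h := by
  rw [self_div_totient_eq_prod hh, Real.exp_sum]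
  refine Finset.prod_le_prod (fun p _ => (Real.exp_pos _).le) fun p hp => ?_
  have hp2 : (2 : ℝ) ≤ p := by exact_mod_cast (Nat.prime_of_mem_primeFactors hp).two_le
  have hp1 : (0 : ℝ) < (p : ℝ) - 1 := by linarith
  -- `e^{1/p} ≤ 1/(1 - 1/p) = p/(p-1)` from `1 - x ≤ e^{-x}`
  have h1 : 1 - 1 / (p : ℝ) ≤ Real.exp (-(1 / (p : ℝ))) := by
    have := Real.add_one_le_exp (-(1 / (p : ℝ))); linarith
  have h2 : 1 - 1 / (p : ℝ) = ((p : ℝ) - 1) / p := by field_simp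
  rw [h2, Real.exp_neg] at h1
  rw [le_div_iff₀ hp1]
  have hp0 : (0 : ℝ) < p := by linarith
  have h3 := mul_le_mul_of_nonneg_left h1 (show 0 ≤ Real.exp (1 / (p : ℝ)) * p by positivity)
  calc Real.exp (1 / (p : ℝ)) * ((p : ℝ) - 1) = Real.exp (1 / (p : ℝ)) * p * (((p : ℝ) - 1) / p) := by
        field_simp
    _ ≤ Real.exp (1 / (p : ℝ)) * p * (Real.exp (1 / (p : ℝ)))⁻¹ := h3
    _ = p := by field_simp

/-- `ψ(h) ≤ (h/φ(h))²` (`(p−1)/(p−2) ≤ (p/(p−1))²` for `p ≥ 3`). [folklore] -/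
theorem psi_le_sq {h : ℕ} (hh : h ≠ 0) :
    ∏ p ∈ h.primeFactors.erase 2, (((p : ℝ) - 1) / ((p : ℝ) - 2)) ≤ ((h : ℝ) / Nat.totient h) ^ 2 := by
  rw [self_div_totient_eq_prod hh, ← Finset.prod_pow]
  have hge1 : ∀ p ∈ h.primeFactors, (1 : ℝ) ≤ ((p : ℝ) / ((p : ℝ) - 1)) ^ 2 := by
    intro p hp
    have hp2 : (2 : ℝ) ≤ p := by exact_mod_cast (Nat.prime_of_mem_primeFactors hp).two_le
    have : (1 : ℝ) ≤ (p : ℝ) / ((p : ℝ) - 1) := by rw [le_div_iff₀ (by linarith)]; linarith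
    exact one_le_pow₀ this
  calc ∏ p ∈ h.primeFactors.erase 2, (((p : ℝ) - 1) / ((p : ℝ) - 2))
      ≤ ∏ p ∈ h.primeFactors.erase 2, ((p : ℝ) / ((p : ℝ) - 1)) ^ 2 := by
        refine Finset.prod_le_prod (fun p hp => ?_) fun p hp => ?_
        · rw [Finset.mem_erase] at hp
          exact zero_le_one.trans (PairShiuLocal.psi_factor_bounds (Nat.prime_of_mem_primeFactors hp.2) hp.1).1
        · rw [Finset.mem_erase] at hp
          have hpp := Nat.prime_of_mem_primeFactors hp.2
          have hp3 : (3 : ℝ) ≤ p := by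
            exact_mod_cast (Nat.succ_le_of_lt (lt_of_le_of_ne hpp.two_le (Ne.symm hp.1)))
          rw [div_pow, div_le_div_iff₀ (by linarith) (pow_pos (by linarith) 2)]
          nlinarith
    _ ≤ ∏ p ∈ h.primeFactors, ((p : ℝ) / ((p : ℝ) - 1)) ^ 2 := by
        by_cases h2 : 2 ∈ h.primeFactors
        · rw [← Finset.mul_prod_erase _ _ h2]
          refine le_mul_of_one_le_left (Finset.prod_nonneg fun p hp => ?_) (hge1 2 h2)
          exact zero_le_one.trans (hge1 p (Finset.mem_of_mem_erase hp))
        · rw [Finset.erase_eq_of_notMem h2]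

/-- `∏_{p ∣ h} (1 + c/p) ≤ (h/φ(h))^c`. [folklore] -/
theorem prod_one_add_div_le_pow {h : ℕ} (hh : h ≠ 0) (c : ℕ) :
    ∏ p ∈ h.primeFactors, (1 + (c : ℝ) / p) ≤ ((h : ℝ) / Nat.totient h) ^ c := by
  rw [self_div_totient_eq_prod hh, ← Finset.prod_pow]
  refine Finset.prod_le_prod (fun p _ => by positivity) fun p hp => ?_
  have hp2 : (2 : ℝ) ≤ p := by exact_mod_cast (Nat.prime_of_mem_primeFactors hp).two_le
  have hp0 : (0 : ℝ) < p := by linarith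
  have h1 : 1 + (c : ℝ) / p ≤ (1 + 1 / (p : ℝ)) ^ c := by
    have h0 : (0 : ℝ) ≤ 1 / (p : ℝ) := by positivity
    have := one_add_mul_le_pow (show (-2 : ℝ) ≤ 1 / (p : ℝ) by linarith) c
    rw [div_eq_mul_one_div]; linarith
  refine h1.trans (pow_le_pow_left₀ (by positivity) ?_ c)
  rw [le_div_iff₀ (by linarith)]
  have : (1 + 1 / (p : ℝ)) * ((p : ℝ) - 1) = (p : ℝ) - 1 / p := by field_simp; ring
  rw [this]
  have : 0 ≤ 1 / (p : ℝ) := by positivity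
  linarith

/-- `1 ≤ h/φ(h)`. [folklore] -/
theorem one_le_self_div_totient {h : ℕ} (hh : h ≠ 0) : (1 : ℝ) ≤ (h : ℝ) / Nat.totient h := by
  have hφ : (0 : ℝ) < Nat.totient h := by exact_mod_cast Nat.totient_pos.mpr (Nat.pos_of_ne_zero hh)
  rw [le_div_iff₀ hφ, one_mul]
  exact_mod_cast Nat.totient_le h

/-! ### Mertens on a window -/

/-- **Mertens on a window**: for `2 ≤ z ≤ X`, `∑_{z ≤ p ≤ X} 1/p ≤ log(log X/log z) + 24`.
[folklore] -/
theorem sum_inv_primes_window_le {z X : ℝ} (hz : 2 ≤ z) (hzX : z ≤ X) :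
    ∑ p ∈ ((Icc 1 ⌊X⌋₊).filter Nat.Prime).filter (fun p : ℕ => z ≤ (p : ℝ)), 1 / (p : ℝ) ≤
      Real.log (Real.log X / Real.log z) + 24 := by
  open Literature.NumberTheory.LFunctions.Mertens in
  have hX : 2 ≤ X := hz.trans hzX
  have hlz : 0 < Real.log z := Real.log_pos (by linarith)
  have hlX : 0 < Real.log X := Real.log_pos (by linarith)
  have hU := abs_primeRecipSum_sub_le hz
  have hV := abs_primeRecipSum_sub_le hX
  rw [abs_le] at hU hV
  have hl2 : Real.log 2 ≤ Real.log z := Real.log_le_log (by norm_num) hz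
  have hl2' : (0.6931471803 : ℝ) < Real.log 2 := Real.log_two_gt_d9
  have h8z : 8 / Real.log z ≤ 11.6 := by rw [div_le_iff₀ hlz]; nlinarith
  have h8X : 8 / Real.log X ≤ 11.6 := by
    rw [div_le_iff₀ hlX]; have := Real.log_le_log (by linarith) hzX; nlinarith
  -- the window sum is `≤ primeRecipSum X − primeRecipSum z + 1/2`
  set S := ((Icc 1 ⌊X⌋₊).filter Nat.Prime).filter (fun p : ℕ => z ≤ (p : ℝ)) with hS
  have hsubV : S ⊆ Nat.primesLE ⌊X⌋₊ := by
    intro p hp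
    rw [hS, Finset.mem_filter, Finset.mem_filter, Finset.mem_Icc] at hp
    exact Nat.mem_primesLE.mpr ⟨hp.1.1.2, hp.1.2⟩
  have hsplit : primeRecipSum X = ∑ p ∈ S, (p : ℝ)⁻¹ + ∑ p ∈ Nat.primesLE ⌊X⌋₊ \ S, (p : ℝ)⁻¹ := by
    rw [primeRecipSum, ← Finset.sum_sdiff hsubV, add_comm]
  -- the complement contains all primes `< z`, i.e. `primesLE ⌊z⌋₊` minus possibly the prime `⌊z⌋₊ = z`
  have hU' : primeRecipSum z ≤ ∑ p ∈ Nat.primesLE ⌊X⌋₊ \ S, (p : ℝ)⁻¹ + 1 / 2 := by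
    rw [primeRecipSum]
    have hz0 : 0 ≤ z := by linarith
    -- split off the primes `p` with `z ≤ p` (at most the single prime `p = ⌊z⌋₊`)
    rw [← Finset.sum_filter_add_sum_filter_not (Nat.primesLE ⌊z⌋₊) (fun p : ℕ => (p : ℝ) < z)]
    refine add_le_add ?_ ?_
    · refine Finset.sum_le_sum_of_subset_of_nonneg (fun p hp => ?_) fun p _ _ => by positivity
      rw [Finset.mem_filter, Nat.mem_primesLE] at hp
      obtain ⟨⟨hpz, hpp⟩, hlt⟩ := hp
      rw [Finset.mem_sdiff, Nat.mem_primesLE, hS, Finset.mem_filter]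
      refine ⟨⟨hpz.trans (Nat.floor_mono hzX), hpp⟩, fun hmem => ?_⟩
      linarith [hmem.2]
    · -- the primes `p ≤ ⌊z⌋₊` with `z ≤ p`: only `p = ⌊z⌋₊`, and `1/p ≤ 1/2`
      have hsub : (Nat.primesLE ⌊z⌋₊).filter (fun p : ℕ => ¬ (p : ℝ) < z) ⊆ {⌊z⌋₊} := by
        intro p hp
        rw [Finset.mem_filter, Nat.mem_primesLE, not_lt] at hp
        rw [Finset.mem_singleton]
        have h1 : (p : ℝ) ≤ ⌊z⌋₊ := by exact_mod_cast hp.1.1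
        have h2 : (⌊z⌋₊ : ℝ) ≤ z := Nat.floor_le hz0
        have h3 : (p : ℝ) = ⌊z⌋₊ := le_antisymm h1 (h2.trans hp.2)
        exact_mod_cast h3
      calc ∑ p ∈ (Nat.primesLE ⌊z⌋₊).filter (fun p : ℕ => ¬ (p : ℝ) < z), (p : ℝ)⁻¹
          ≤ ∑ p ∈ ({⌊z⌋₊} : Finset ℕ), (p : ℝ)⁻¹ :=
            Finset.sum_le_sum_of_subset_of_nonneg hsub fun p _ _ => by positivity
        _ = ((⌊z⌋₊ : ℕ) : ℝ)⁻¹ := Finset.sum_singleton _ _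
        _ ≤ 1 / 2 := by
            have : (2 : ℝ) ≤ ⌊z⌋₊ := by exact_mod_cast Nat.le_floor (by exact_mod_cast hz)
            rw [inv_eq_one_div]; exact div_le_div_of_nonneg_left zero_le_one (by norm_num) this
  have hwin : ∑ p ∈ S, (p : ℝ)⁻¹ ≤ primeRecipSum X - primeRecipSum z + 1 / 2 := by linarith
  have hmain : ∑ p ∈ S, (p : ℝ)⁻¹ ≤ Real.log (Real.log X) - Real.log (Real.log z) + 8 / Real.log X + 8 / Real.log z + 1 / 2 := by
    linarith [hV.2, hU.1]
  rw [Real.log_div hlX.ne' hlz.ne']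
  calc ∑ p ∈ S, 1 / (p : ℝ) = ∑ p ∈ S, (p : ℝ)⁻¹ := Finset.sum_congr rfl fun p _ => one_div _
    _ ≤ _ := by linarith


/-! ### Divisor powers on rough numbers -/

/-- `τ(p^l) = l + 1 ≤ 2^l`. [folklore] -/
theorem card_divisors_prime_pow_le {p : ℕ} (hp : p.Prime) (l : ℕ) :
    ((p ^ l).divisors.card : ℝ) ≤ (2 : ℝ) ^ l := by
  rw [Nat.divisors_prime_pow hp, Finset.card_map, Finset.card_range]
  have : l + 1 ≤ 2 ^ l := Nat.lt_two_pow_self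
  exact_mod_cast this

set_option maxHeartbeats 1600000 in
/-- **Matomäki–Merikoski Lemma 3.1, sharp form, for the pair `(n, mn + h)`.** For `a, b ∈ ℕ` there
are `C, X₀` such that for `X ≥ X₀`, `1 ≤ m ≤ X`, `1 ≤ h ≤ X`, `(m, h) = 1`, `2 ≤ z₁, z₂ ≤ X`:
`∑_{n ≤ X, n z₁-rough, (mn+h, P_h(z₂)) = 1} τ(n)^a τ(mn+h)^b`
`≤ C (h/φ(h))^{2 + 2^{a+b+2} + 2^b} ψ(m) (X/log² X) (log X/log z₁)^{2^a} (log X/log z₂)^{2^b}`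
("`(k, P_h(z)) = 1`": every prime factor `p < z` of `k` divides `h`; `ψ(m) = ∏_{p∣m, p≠2}(p−1)/(p−2)`).
The source (Lemma 3.1 (i): `m = 1`; (ii): `b = 2`, `a = 0`) has `h/φ(h)` to the first power and,
in (i), an extra factor `log X/log w₁`; it rests on Henriot's bound, replaced here by `pair_shiu`.
[cite: MatomakiMerikoski2023, Lemma 3.1] -/
theorem sum_rough_pair_divisors_pow_le (a b : ℕ) : ∃ C X₀ : ℝ, 0 < C ∧
    ∀ (X : ℝ) (m h : ℕ) (z₁ z₂ : ℝ), X₀ ≤ X → 1 ≤ m → (m : ℝ) ≤ X → 1 ≤ h → (h : ℝ) ≤ X →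
      m.Coprime h → 2 ≤ z₁ → z₁ ≤ X → 2 ≤ z₂ → z₂ ≤ X →
      ∑ n ∈ (Icc 1 ⌊X⌋₊).filter (fun n : ℕ => (∀ p ∈ n.primeFactors, z₁ ≤ (p : ℝ)) ∧
          (∀ p ∈ (m * n + h).primeFactors, z₂ ≤ (p : ℝ) ∨ p ∣ h)),
        ((n.divisors.card : ℝ)) ^ a * (((m * n + h).divisors.card : ℝ)) ^ b ≤
      C * ((h : ℝ) / Nat.totient h) ^ (2 + 2 ^ (a + b + 2) + 2 ^ b) *
        (∏ p ∈ m.primeFactors.erase 2, (((p : ℝ) - 1) / ((p : ℝ) - 2))) *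
        (X / Real.log X ^ 2) * (Real.log X / Real.log z₁) ^ (2 ^ a) *
        (Real.log X / Real.log z₂) ^ (2 ^ b) := by
  classical
  -- the divisor bound as a function of `ε`
  set c : ℕ := a + b + 1 with hc
  have hc1 : 1 ≤ c := by omega
  set Cd : ℝ → ℝ := fun ε => if hε : 0 < ε then Classical.choose (exists_card_divisors_le_mul_rpow' hε) else 1
    with hCd
  have hCd_spec : ∀ ε : ℝ, 0 < ε → 1 ≤ Cd ε ∧ ∀ n : ℕ, (n.divisors.card : ℝ) ≤ Cd ε * (n : ℝ) ^ ε := by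
    intro ε hε
    have := Classical.choose_spec (exists_card_divisors_le_mul_rpow' hε)
    simp only [hCd, dif_pos hε]
    exact this
  set A₂ : ℝ → ℝ := fun δ => Cd (δ / c) ^ c with hA₂
  set B : ℝ := (2 : ℝ) ^ (a + b) with hB
  have hB1 : 1 ≤ B := one_le_pow₀ (by norm_num)
  obtain ⟨C₀, X₀, hC₀, H⟩ := pair_shiu 1 hB1 A₂
  set κ : ℕ := 2 + 2 ^ (a + b + 2) + 2 ^ b with hκ
  refine ⟨C₀ * Real.exp (24 * ((2 : ℝ) ^ a + (2 : ℝ) ^ b)), max X₀ 2, by positivity, ?_⟩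
  intro X m h z₁ z₂ hX hm hmX hh hhX hmh hz₁ hz₁X hz₂ hz₂X
  have hX₀ : X₀ ≤ X := le_trans (le_max_left _ _) hX
  have hX2 : 2 ≤ X := le_trans (le_max_right _ _) hX
  have hX0 : 0 < X := by linarith
  have hh0 : h ≠ 0 := by omega
  set N : ℕ := ⌊X⌋₊ with hN
  -- the two multiplicative functions
  set f : ℕ → ℝ := fun n => if ∀ p ∈ n.primeFactors, z₁ ≤ (p : ℝ) then ((n.divisors.card : ℝ)) ^ a else 0
    with hf
  set g : ℕ → ℝ := fun n => if ∀ p ∈ n.primeFactors, z₂ ≤ (p : ℝ) ∨ p ∣ h then ((n.divisors.card : ℝ)) ^ b else 0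
    with hg
  have hf0 : ∀ n, 0 ≤ f n := fun n => by simp only [hf]; split_ifs <;> positivity
  have hg0 : ∀ n, 0 ≤ g n := fun n => by simp only [hg]; split_ifs <;> positivity
  have hpf1 : ∀ (P : ℕ → Prop), ∀ p ∈ (1 : ℕ).primeFactors, P p := by
    intro P p hp; rw [Nat.primeFactors_one] at hp; exact absurd hp (Finset.notMem_empty p)
  have hf1 : f 1 = 1 := by
    simp only [hf, if_pos (hpf1 (fun p => z₁ ≤ (p : ℝ))), Nat.divisors_one, Finset.card_singleton, Nat.cast_one, one_pow]
  have hg1 : g 1 = 1 := by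
    simp only [hg, if_pos (hpf1 (fun p => z₂ ≤ (p : ℝ) ∨ p ∣ h)), Nat.divisors_one, Finset.card_singleton,
      Nat.cast_one, one_pow]
  have hτmul : ∀ u v : ℕ, u.Coprime v → ((u * v).divisors.card : ℝ) = u.divisors.card * v.divisors.card := by
    intro u v huv; exact_mod_cast huv.card_divisors_mul
  have hfmul : ∀ u v : ℕ, u.Coprime v → f (u * v) = f u * f v := by
    intro u v huv
    by_cases hu0 : u = 0
    · subst hu0
      have hv1 : v = 1 := (Nat.coprime_zero_left _).mp huv
      subst hv1; rw [mul_one, hf1, mul_one]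
    by_cases hv0 : v = 0
    · subst hv0
      have hu1 : u = 1 := (Nat.coprime_zero_right _).mp huv
      subst hu1; rw [one_mul, hf1, one_mul]
    simp only [hf, Nat.primeFactors_mul hu0 hv0, Finset.forall_mem_union]
    by_cases h1 : ∀ p ∈ u.primeFactors, z₁ ≤ (p : ℝ)
    · by_cases h2 : ∀ p ∈ v.primeFactors, z₁ ≤ (p : ℝ)
      · rw [if_pos ⟨h1, h2⟩, if_pos h1, if_pos h2, hτmul u v huv, mul_pow]
      · rw [if_neg (fun h' => h2 h'.2), if_neg h2, mul_zero]
    · rw [if_neg (fun h' => h1 h'.1), if_neg h1, zero_mul]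
  have hgmul : ∀ u v : ℕ, u.Coprime v → g (u * v) = g u * g v := by
    intro u v huv
    by_cases hu0 : u = 0
    · subst hu0
      have hv1 : v = 1 := (Nat.coprime_zero_left _).mp huv
      subst hv1; rw [mul_one, hg1, mul_one]
    by_cases hv0 : v = 0
    · subst hv0
      have hu1 : u = 1 := (Nat.coprime_zero_right _).mp huv
      subst hu1; rw [one_mul, hg1, one_mul]
    simp only [hg, Nat.primeFactors_mul hu0 hv0, Finset.forall_mem_union]
    by_cases h1 : ∀ p ∈ u.primeFactors, z₂ ≤ (p : ℝ) ∨ p ∣ h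
    · by_cases h2 : ∀ p ∈ v.primeFactors, z₂ ≤ (p : ℝ) ∨ p ∣ h
      · rw [if_pos ⟨h1, h2⟩, if_pos h1, if_pos h2, hτmul u v huv, mul_pow]
      · rw [if_neg (fun h' => h2 h'.2), if_neg h2, mul_zero]
    · rw [if_neg (fun h' => h1 h'.1), if_neg h1, zero_mul]
  have hpowB : ∀ (p l e : ℕ), p.Prime → e ≤ a + b → (((p ^ l).divisors.card : ℝ)) ^ e ≤ B ^ l := by
    intro p l e hp he
    calc (((p ^ l).divisors.card : ℝ)) ^ e ≤ ((2 : ℝ) ^ l) ^ e :=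
          pow_le_pow_left₀ (Nat.cast_nonneg _) (card_divisors_prime_pow_le hp l) e
      _ = ((2 : ℝ) ^ e) ^ l := by rw [← pow_mul, ← pow_mul, mul_comm]
      _ ≤ ((2 : ℝ) ^ (a + b)) ^ l := pow_le_pow_left₀ (by positivity) (pow_le_pow_right₀ (by norm_num) he) l
  have hfB : ∀ p l : ℕ, p.Prime → 1 ≤ l → f (p ^ l) ≤ B ^ l := by
    intro p l hp _
    simp only [hf]
    split_ifs
    · exact hpowB p l a hp (by omega)
    · positivity
  have hgB : ∀ p l : ℕ, p.Prime → 1 ≤ l → g (p ^ l) ≤ B ^ l := by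
    intro p l hp _
    simp only [hg]
    split_ifs
    · exact hpowB p l b hp (by omega)
    · positivity
  have hτA : ∀ (δ : ℝ), 0 < δ → ∀ (n e : ℕ), 1 ≤ n → e ≤ c → ((n.divisors.card : ℝ)) ^ e ≤ A₂ δ * (n : ℝ) ^ δ := by
    intro δ hδ n e hn he
    have hδc : 0 < δ / c := div_pos hδ (by exact_mod_cast (show 0 < c by omega))
    obtain ⟨hC1, hCb⟩ := hCd_spec (δ / c) hδc
    have hn1 : (1 : ℝ) ≤ n := by exact_mod_cast hn
    have h1 : ((n.divisors.card : ℝ)) ^ e ≤ (Cd (δ / c) * (n : ℝ) ^ (δ / c)) ^ e :=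
      pow_le_pow_left₀ (Nat.cast_nonneg _) (hCb n) e
    have hbase : 1 ≤ Cd (δ / c) * (n : ℝ) ^ (δ / c) :=
      one_le_mul_of_one_le_of_one_le hC1 (Real.one_le_rpow hn1 hδc.le)
    have h2 : (Cd (δ / c) * (n : ℝ) ^ (δ / c)) ^ e ≤ (Cd (δ / c) * (n : ℝ) ^ (δ / c)) ^ c :=
      pow_le_pow_right₀ hbase he
    have h3 : (Cd (δ / c) * (n : ℝ) ^ (δ / c)) ^ c = A₂ δ * (n : ℝ) ^ δ := by
      rw [mul_pow, hA₂, ← Real.rpow_natCast ((n : ℝ) ^ (δ / c)), ← Real.rpow_mul (by positivity)]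
      congr 2
      field_simp
    exact h1.trans (h2.trans h3.le)
  have hfA₂ : ∀ δ : ℝ, 0 < δ → ∀ n : ℕ, 1 ≤ n → f n ≤ A₂ δ * (n : ℝ) ^ δ := by
    intro δ hδ n hn
    simp only [hf]
    split_ifs
    · exact hτA δ hδ n a hn (by omega)
    · have := (hCd_spec (δ / c) (div_pos hδ (by exact_mod_cast (show 0 < c by omega)))).1
      have : 0 ≤ A₂ δ := by simp only [hA₂]; positivity
      positivity
  have hgA₂ : ∀ δ : ℝ, 0 < δ → ∀ n : ℕ, 1 ≤ n → g n ≤ A₂ δ * (n : ℝ) ^ δ := by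
    intro δ hδ n hn
    simp only [hg]
    split_ifs
    · exact hτA δ hδ n b hn (by omega)
    · have := (hCd_spec (δ / c) (div_pos hδ (by exact_mod_cast (show 0 < c by omega)))).1
      have : 0 ≤ A₂ δ := by simp only [hA₂]; positivity
      positivity
  -- apply `pair_shiu`
  have hmX' : (m : ℝ) ≤ X ^ (1 : ℕ) := by rwa [pow_one]
  have hhX' : (h : ℝ) ≤ X ^ (1 : ℕ) := by rwa [pow_one]
  have hmain := H f g hf0 hg0 hf1 hg1 hfmul hgmul hfB hgB hfA₂ hgA₂ X m h hX₀ hm hmX' hh hhX' hmh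
  -- the left-hand sides agree on the filter
  set S := (Icc 1 N).filter (fun n : ℕ => (∀ p ∈ n.primeFactors, z₁ ≤ (p : ℝ)) ∧
      (∀ p ∈ (m * n + h).primeFactors, z₂ ≤ (p : ℝ) ∨ p ∣ h)) with hS
  have hLHS : ∑ n ∈ S, ((n.divisors.card : ℝ)) ^ a * (((m * n + h).divisors.card : ℝ)) ^ b ≤
      ∑ n ∈ Icc 1 N, f n * g (m * n + h) := by
    have h1 : ∑ n ∈ S, ((n.divisors.card : ℝ)) ^ a * (((m * n + h).divisors.card : ℝ)) ^ b =
        ∑ n ∈ S, f n * g (m * n + h) := by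
      refine Finset.sum_congr rfl fun n hn => ?_
      rw [hS, Finset.mem_filter] at hn
      simp only [hf, hg, if_pos hn.2.1, if_pos hn.2.2]
    rw [h1]
    exact Finset.sum_le_sum_of_subset_of_nonneg (Finset.filter_subset _ _) fun n _ _ =>
      mul_nonneg (hf0 n) (hg0 _)
  refine hLHS.trans (hmain.trans ?_)
  -- the factors of the right-hand side
  set F : ℝ := (h : ℝ) / Nat.totient h with hF
  have hF1 : 1 ≤ F := one_le_self_div_totient hh0
  set ψm : ℝ := ∏ p ∈ m.primeFactors.erase 2, (((p : ℝ) - 1) / ((p : ℝ) - 2)) with hψm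
  have hψm0 : 0 ≤ ψm := PairShiuLocal.psi_nonneg m
  have hψh : ∏ p ∈ h.primeFactors.erase 2, (((p : ℝ) - 1) / ((p : ℝ) - 2)) ≤ F ^ 2 := psi_le_sq hh0
  have hΔ : ∏ p ∈ h.primeFactors, (1 + 4 * f p * g p / p) ≤ F ^ (2 ^ (a + b + 2)) := by
    refine le_trans ?_ (prod_one_add_div_le_pow hh0 (2 ^ (a + b + 2)))
    refine Finset.prod_le_prod (fun p _ => by have := hf0 p; have := hg0 p; positivity) fun p hp => ?_
    have hpp := Nat.prime_of_mem_primeFactors hp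
    have hp0 : (0 : ℝ) < p := by exact_mod_cast hpp.pos
    have hτp : (p.divisors.card : ℝ) = 2 := by
      rw [Nat.Prime.divisors hpp, Finset.card_pair hpp.one_lt.ne]; norm_num
    have hfp : f p ≤ (2 : ℝ) ^ a := by
      simp only [hf]; split_ifs
      · rw [hτp]
      · positivity
    have hgp : g p ≤ (2 : ℝ) ^ b := by
      simp only [hg]; split_ifs
      · rw [hτp]
      · positivity
    have h4 : 4 * f p * g p ≤ ((2 ^ (a + b + 2) : ℕ) : ℝ) := by
      push_cast
      rw [pow_add, pow_add]
      have := hf0 p; have := hg0 p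
      nlinarith [mul_le_mul hfp hgp (hg0 p) (by positivity)]
    have := div_le_div_of_nonneg_right h4 hp0.le
    linarith
  -- the prime sums
  have hprimes : ∀ p ∈ (Icc 1 N).filter Nat.Prime, p.Prime := fun p hp => (Finset.mem_filter.mp hp).2
  have hSf : ∑ p ∈ (Icc 1 N).filter Nat.Prime, f p / p ≤ (2 : ℝ) ^ a * (Real.log (Real.log X / Real.log z₁) + 24) := by
    have h1 : ∀ p ∈ (Icc 1 N).filter Nat.Prime, f p / p ≤
        (2 : ℝ) ^ a * (if z₁ ≤ (p : ℝ) then 1 / (p : ℝ) else 0) := by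
      intro p hp
      have hpp := hprimes p hp
      have hp0 : (0 : ℝ) < p := by exact_mod_cast hpp.pos
      have hτp : (p.divisors.card : ℝ) = 2 := by
        rw [Nat.Prime.divisors hpp, Finset.card_pair hpp.one_lt.ne]; norm_num
      simp only [hf, Nat.Prime.primeFactors hpp]
      by_cases hz : z₁ ≤ (p : ℝ)
      · rw [if_pos (fun q hq => by rw [Finset.mem_singleton] at hq; rw [hq]; exact hz), if_pos hz, hτp]
        exact le_of_eq (by ring)
      · rw [if_neg (fun h' => hz (h' p (Finset.mem_singleton_self p))), if_neg hz]; simp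
    refine (Finset.sum_le_sum h1).trans ?_
    rw [← Finset.mul_sum, ← Finset.sum_filter]
    exact mul_le_mul_of_nonneg_left (sum_inv_primes_window_le hz₁ hz₁X) (by positivity)
  have hSg : ∑ p ∈ (Icc 1 N).filter Nat.Prime, g p / p ≤
      (2 : ℝ) ^ b * (Real.log (Real.log X / Real.log z₂) + 24) + (2 : ℝ) ^ b * ∑ p ∈ h.primeFactors, 1 / (p : ℝ) := by
    have h1 : ∀ p ∈ (Icc 1 N).filter Nat.Prime, g p / p ≤
        (2 : ℝ) ^ b * (if z₂ ≤ (p : ℝ) then 1 / (p : ℝ) else 0) +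
          (2 : ℝ) ^ b * (if p ∣ h then 1 / (p : ℝ) else 0) := by
      intro p hp
      have hpp := hprimes p hp
      have hp0 : (0 : ℝ) < p := by exact_mod_cast hpp.pos
      have hτp : (p.divisors.card : ℝ) = 2 := by
        rw [Nat.Prime.divisors hpp, Finset.card_pair hpp.one_lt.ne]; norm_num
      simp only [hg, Nat.Prime.primeFactors hpp]
      have h2b : (0 : ℝ) ≤ 2 ^ b * (1 / (p : ℝ)) := by positivity
      have hval : (if ∀ q ∈ ({p} : Finset ℕ), z₂ ≤ (q : ℝ) ∨ q ∣ h then ((p.divisors.card : ℝ)) ^ b else 0) / p ≤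
          (2 : ℝ) ^ b * (1 / (p : ℝ)) := by
        split_ifs
        · rw [hτp]; exact le_of_eq (by ring)
        · rw [zero_div]; exact h2b
      by_cases hz : z₂ ≤ (p : ℝ)
      · rw [if_pos hz]
        have : (0 : ℝ) ≤ 2 ^ b * (if p ∣ h then 1 / (p : ℝ) else 0) := by split_ifs <;> positivity
        linarith
      · rw [if_neg hz, mul_zero, zero_add]
        by_cases hdvd : p ∣ h
        · rw [if_pos hdvd]; exact hval
        · rw [if_neg hdvd, mul_zero, if_neg (fun h' => ?_), zero_div]
          rcases h' p (Finset.mem_singleton_self p) with h1 | h1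
          · exact hz h1
          · exact hdvd h1
    refine (Finset.sum_le_sum h1).trans ?_
    rw [Finset.sum_add_distrib, ← Finset.mul_sum, ← Finset.mul_sum, ← Finset.sum_filter, ← Finset.sum_filter]
    refine add_le_add (mul_le_mul_of_nonneg_left (sum_inv_primes_window_le hz₂ hz₂X) (by positivity))
      (mul_le_mul_of_nonneg_left ?_ (by positivity))
    refine Finset.sum_le_sum_of_subset_of_nonneg (fun p hp => ?_) fun p _ _ => by positivity
    rw [Finset.mem_filter] at hp
    exact Nat.mem_primeFactors.mpr ⟨hprimes p hp.1, hp.2, hh0⟩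
  -- the exponential
  have hl₁ : 0 < Real.log z₁ := Real.log_pos (by linarith)
  have hl₂ : 0 < Real.log z₂ := Real.log_pos (by linarith)
  have hlX : 0 < Real.log X := Real.log_pos (by linarith)
  have hr₁ : 0 < Real.log X / Real.log z₁ := div_pos hlX hl₁
  have hr₂ : 0 < Real.log X / Real.log z₂ := div_pos hlX hl₂
  have hexp : Real.exp (∑ p ∈ (Icc 1 N).filter Nat.Prime, f p / p + ∑ p ∈ (Icc 1 N).filter Nat.Prime, g p / p) ≤
      Real.exp (24 * ((2 : ℝ) ^ a + (2 : ℝ) ^ b)) * (Real.log X / Real.log z₁) ^ (2 ^ a) *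
        (Real.log X / Real.log z₂) ^ (2 ^ b) * F ^ (2 ^ b) := by
    have h1 : ∑ p ∈ (Icc 1 N).filter Nat.Prime, f p / p + ∑ p ∈ (Icc 1 N).filter Nat.Prime, g p / p ≤
        24 * ((2 : ℝ) ^ a + (2 : ℝ) ^ b) + (2 : ℝ) ^ a * Real.log (Real.log X / Real.log z₁) +
          (2 : ℝ) ^ b * Real.log (Real.log X / Real.log z₂) + (2 : ℝ) ^ b * ∑ p ∈ h.primeFactors, 1 / (p : ℝ) := by
      linarith
    refine (Real.exp_le_exp.2 h1).trans ?_
    rw [Real.exp_add, Real.exp_add, Real.exp_add]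
    have e1 : Real.exp ((2 : ℝ) ^ a * Real.log (Real.log X / Real.log z₁)) = (Real.log X / Real.log z₁) ^ (2 ^ a) := by
      rw [← Real.exp_log (pow_pos hr₁ (2 ^ a)), Real.log_pow]; congr 1; push_cast; ring
    have e2 : Real.exp ((2 : ℝ) ^ b * Real.log (Real.log X / Real.log z₂)) = (Real.log X / Real.log z₂) ^ (2 ^ b) := by
      rw [← Real.exp_log (pow_pos hr₂ (2 ^ b)), Real.log_pow]; congr 1; push_cast; ring
    have e3 : Real.exp ((2 : ℝ) ^ b * ∑ p ∈ h.primeFactors, 1 / (p : ℝ)) =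
        Real.exp (∑ p ∈ h.primeFactors, 1 / (p : ℝ)) ^ (2 ^ b) := by
      rw [← Real.exp_nat_mul]; norm_num
    rw [e1, e2, e3]
    have := exp_sum_inv_primeFactors_le hh0
    gcongr
  -- combine
  have hΔ0 : 0 ≤ ∏ p ∈ h.primeFactors, (1 + 4 * f p * g p / p) :=
    Finset.prod_nonneg fun p _ => by have := hf0 p; have := hg0 p; positivity
  have hψh0 : 0 ≤ ∏ p ∈ h.primeFactors.erase 2, (((p : ℝ) - 1) / ((p : ℝ) - 2)) := PairShiuLocal.psi_nonneg h
  have hXL : 0 ≤ X / Real.log X ^ 2 := by positivity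
  calc C₀ * (∏ p ∈ h.primeFactors.erase 2, (((p : ℝ) - 1) / ((p : ℝ) - 2))) * ψm *
        (∏ p ∈ h.primeFactors, (1 + 4 * f p * g p / p)) * (X / Real.log X ^ 2) *
        Real.exp (∑ p ∈ (Icc 1 N).filter Nat.Prime, f p / p + ∑ p ∈ (Icc 1 N).filter Nat.Prime, g p / p)
      ≤ C₀ * F ^ 2 * ψm * F ^ (2 ^ (a + b + 2)) * (X / Real.log X ^ 2) *
        (Real.exp (24 * ((2 : ℝ) ^ a + (2 : ℝ) ^ b)) * (Real.log X / Real.log z₁) ^ (2 ^ a) *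
          (Real.log X / Real.log z₂) ^ (2 ^ b) * F ^ (2 ^ b)) := by
        have hF0 : 0 ≤ F := zero_le_one.trans hF1
        have h1 : C₀ * (∏ p ∈ h.primeFactors.erase 2, (((p : ℝ) - 1) / ((p : ℝ) - 2))) * ψm ≤ C₀ * F ^ 2 * ψm :=
          mul_le_mul_of_nonneg_right (mul_le_mul_of_nonneg_left hψh hC₀.le) hψm0
        have h2 : C₀ * (∏ p ∈ h.primeFactors.erase 2, (((p : ℝ) - 1) / ((p : ℝ) - 2))) * ψm *
            (∏ p ∈ h.primeFactors, (1 + 4 * f p * g p / p)) ≤ C₀ * F ^ 2 * ψm * F ^ (2 ^ (a + b + 2)) :=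
          mul_le_mul h1 hΔ hΔ0 (by positivity)
        have h3 := mul_le_mul_of_nonneg_right h2 hXL
        exact mul_le_mul h3 hexp (Real.exp_pos _).le (by positivity)
    _ = C₀ * Real.exp (24 * ((2 : ℝ) ^ a + (2 : ℝ) ^ b)) * F ^ κ * ψm * (X / Real.log X ^ 2) *
        (Real.log X / Real.log z₁) ^ (2 ^ a) * (Real.log X / Real.log z₂) ^ (2 ^ b) := by
        rw [hκ, pow_add, pow_add]; ring


/-- **The same with plain `z₂`-roughness of `mn + h`** (the summand set only shrinks).
[cite: MatomakiMerikoski2023, Lemma 3.1 (ii)] -/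
theorem sum_rough_pair_divisors_pow_le' (a b : ℕ) : ∃ C X₀ : ℝ, 0 < C ∧
    ∀ (X : ℝ) (m h : ℕ) (z₁ z₂ : ℝ), X₀ ≤ X → 1 ≤ m → (m : ℝ) ≤ X → 1 ≤ h → (h : ℝ) ≤ X →
      m.Coprime h → 2 ≤ z₁ → z₁ ≤ X → 2 ≤ z₂ → z₂ ≤ X →
      ∑ n ∈ (Icc 1 ⌊X⌋₊).filter (fun n : ℕ => (∀ p ∈ n.primeFactors, z₁ ≤ (p : ℝ)) ∧
          (∀ p ∈ (m * n + h).primeFactors, z₂ ≤ (p : ℝ))),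
        ((n.divisors.card : ℝ)) ^ a * (((m * n + h).divisors.card : ℝ)) ^ b ≤
      C * ((h : ℝ) / Nat.totient h) ^ (2 + 2 ^ (a + b + 2) + 2 ^ b) *
        (∏ p ∈ m.primeFactors.erase 2, (((p : ℝ) - 1) / ((p : ℝ) - 2))) *
        (X / Real.log X ^ 2) * (Real.log X / Real.log z₁) ^ (2 ^ a) *
        (Real.log X / Real.log z₂) ^ (2 ^ b) := by
  obtain ⟨C, X₀, hC, H⟩ := sum_rough_pair_divisors_pow_le a b
  refine ⟨C, X₀, hC, ?_⟩
  intro X m h z₁ z₂ hX hm hmX hh hhX hmh hz₁ hz₁X hz₂ hz₂X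
  refine le_trans ?_ (H X m h z₁ z₂ hX hm hmX hh hhX hmh hz₁ hz₁X hz₂ hz₂X)
  refine Finset.sum_le_sum_of_subset_of_nonneg (fun n hn => ?_) fun n _ _ => by positivity
  rw [Finset.mem_filter] at hn ⊢
  exact ⟨hn.1, hn.2.1, fun p hp => Or.inl (hn.2.2 p hp)⟩

end PairShiu

end Literature.NumberTheory.Sieve
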